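import Summits.BirchSwinnertonDyer.BirchSwinnertonDyer.Theorems.KimAtThreeDeepLowerOffStratumLevelLoweringDepleteTamagawaRowsClass
import HarnessLib

/-!
# Route `KimAtThreeKolyvagin` (rung W2), crux `DeepLowerAtThreeOffKatoStratum` (item 19679), registered
# stub `stub_nonAdditive`: the (A) rows and the (A) class under the COVERED consumer — «ordinary if good,
# (ram) only if `3` is multiplicative»

Cell `bsd-addord`, seat `bsd-addord-w2-acc2`, gen 8; item `stmt-BirchSwinnertonDyer-19679` (`--supports`, closes
nothing). ROAD (b^k,add,A) file 4. ★¹² (`…DepleteTamagawaRows`) and ★¹³ (`…DepleteTamagawaRowsClass`) feed the (LL₁)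
certificates ★¹²ᵃ / ★¹³ᵃ to the (ram) consumer (Skinner 2016 Thm. C needs a multiplicative prime at which `ρ̄` is
ramified, `Ram W₀ 3`). On the rows that are GOOD ORDINARY at `3` the lower half of BSD₃ is also available WITHOUT (ram)
from gen 0/2's covered consumer `…LevelLoweringBridge.stub_nonAdditive_covered_of_plusSymbolLevelLowersOver` (named facts
`hYZ` = Yan–Zhu, PRE-tier print, `hW20`, `hSk`, `hmod`, `hGZK`, `hM`), which asks `Ram W₀ 3` only when `3` is
multiplicative. THIS FILE records the two covered twins (gen 7's census: 1 229 (A) rows without (ram)). Theorems only;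
nothing booked; BSD is not proved by any of this; the Yan–Zhu binder is displayed BY NAME and is preprint-tier.

* §1 ★¹²ᶜ `stub_nonAdditive_covered_of_exists_levelLoweredNewform_depleteAt` (row data).
* §2 ★¹³ᶜ `stub_nonAdditive_covered_tamagawaDepthOne_of_additiveTamagawa` (class).
[cite: YanZhu2024MainConjNonCM, Thm. 4.15 (§4.6)] [cite: Skinner2016PacificMC, Thm. C (§1)] [cite: Mazur1978, Cor. 4.1]
[cite: DiamondRibet1997, §4.5 Lemma 4.6] [cite: DarmonDiamondTaylor1995, Thm. 3.15, Thm. 3.1 (e)]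
[cite: Kim2022StructureSelmer, Conj. 1.10 (PDF p. 8)]
-/

set_option autoImplicit false
-- the Theorems namespace of a single-conjunct summit repeats the summit name by design (D-0017)
set_option linter.dupNamespace false

noncomputable section

open scoped MatrixGroups ModularForm Classical NNReal NumberField

open CongruenceSubgroup WeierstrassCurve Literature.NumberTheory.EllipticCurves
  Literature.NumberTheory.EllipticCurves.ModularForms IsDedekindDomain NumberField Rat.HeightOneSpectrum

namespace Summit.BirchSwinnertonDyer.BirchSwinnertonDyer.Theorems.KimAtThreeDeepLowerOffStratumLevelLoweringDepleteTamagawaRowsCovered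

open Summit.BirchSwinnertonDyer.BirchSwinnertonDyer.Theorems.KimAtThreeDeepLowerOffStratumLevelLoweringBridge
open Summit.BirchSwinnertonDyer.BirchSwinnertonDyer.Theorems.KimAtThreeDeepLowerOffStratumLevelLoweringRekey
open Summit.BirchSwinnertonDyer.BirchSwinnertonDyer.Theorems.KimAtThreeDeepLowerOffStratumLevelLoweringDepleteTamagawaRows
open Summit.BirchSwinnertonDyer.BirchSwinnertonDyer.Theorems.KimAtThreeDeepLowerOffStratumLevelLoweringDepleteTamagawaRowsClass
open Literature.NumberTheory.EllipticCurves.Rank1Residual Literature.NumberTheory.EllipticCurves.Rank1Residual.Typed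
  Literature.NumberTheory.EllipticCurves.Skinner2016 Literature.NumberTheory.Automorphic
open IsDedekindDomain Rat.HeightOneSpectrum

/-! ### §1 ★¹²ᶜ The (A) rows with row data, covered consumer -/

section Rows

/-- ★¹²ᶜ **The same on the COVERED rows (no `Ram` when `3` is good): «ordinary if good, (ram) if multiplicative»** —
★¹²ᵃ's certificate fed to gen 2's covered consumer `…LevelLoweringBridge.stub_nonAdditive_covered_of_plusSymbolLevelLowersOver`
(named facts `hYZ hW20 hSk hmod hGZK hM`; the Yan–Zhu binder is PRE-tier print). [cite: YanZhu2024MainConjNonCM, Thm. 4.15 (§4.6)]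
[cite: Skinner2016PacificMC, Thm. C (§1)] [cite: DiamondRibet1997, §4.5 Lemma 4.6] [cite: DarmonDiamondTaylor1995, Thm. 3.1 (e)] -/
theorem stub_nonAdditive_covered_of_exists_levelLoweredNewform_depleteAt
    (hDR : diamondRibet1997_iharaLemma_at_dividingPrime_three_additive)
    (hCa : carayol1986_cuspCoeff_congr_at_additiveDrop_three)
    (hCE : colemanEdixhoven1998_heckePolynomial_simpleRoots)
    (hV : vatsal1999_plusSymbol_congruence) (hGV : greenbergVatsal2000_plusSymbol_congruence)
    (hYZ : YanZhu2026.thm415_padicValRat_bsd_rank_le_one)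
    (hW20 : Wuthrich2014.lemma20_surjective_threeAdic_of_semistable)
    (hSk : Skinner2016.thmC_padicValRat_bsd_rank_zero)
    (hmod : hasEntireLFunction_rat) (hGZK : rank_eq_analyticRank_of_analyticRank_le_one)
    (hM : mazur_not_dvd_maninConstant_of_odd) :
    ∀ (W₀ : WeierstrassCurve ℚ) [W₀.IsElliptic] [W₀.IsGloballyMinimal],
      (∀ n : ℕ, W₀.HasSurjectiveModNGaloisRep (3 ^ n : ℕ)) → Finite W₀.sha →
      ∀ {N : ℕ} [NeZero N], N = W₀.conductorNorm ℤ →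
      ∀ (D₀ : ModularParametrizationData W₀ N),
        (∀ z ∈ D₀.L.lattice, ∃ w ∈ periodLattice D₀.f, z = D₀.c * w) →
        (∀ (W₂ : WeierstrassCurve ℚ) [W₂.IsElliptic] (D₂ : ModularParametrizationData W₂ N),
          D₂.f = D₀.f → D₀.modularDegree ≤ D₂.modularDegree) →
        (∀ r : ℚ, ratPlusSymbol D₀.f r ≠ 0 → 0 ≤ padicValRat 3 (ratPlusSymbol D₀.f r)) →
        kuriharaVanishingOrder W₀ 3 D₀.f = 0 →
        ¬ (haveI : Fact (Nat.Prime 3) := ⟨Nat.prime_three⟩; Addv W₀ 3) →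
        (W₀.HasGoodReductionAtPrime 3 → ¬ (3 : ℤ) ∣ W₀.frobeniusTrace 3) →
        (W₀.HasMultiplicativeReductionAtPrime 3 →
          (haveI : Fact (Nat.Prime 3) := ⟨Nat.prime_three⟩; Ram W₀ 3)) →
        padicValNat 3 W₀.tamagawaProduct ≤ 1 →
        ∀ {M₁ D A ℓ : ℕ} [NeZero M₁] [Fact ℓ.Prime] (v : HeightOneSpectrum ℤ), M₁ * D * A * ℓ = N →
        natGenerator v = ℓ → W₀.HasAdditiveReductionAt v → 3 ∣ (W₀.kodairaSymbolAt v).componentGroupOrder →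
        3 ∣ (W₀.baseChange ℚ_[ℓ]).localTamagawaNumber ℤ_[ℓ] →
        ℓ ∣ M₁ → ¬ ℓ ^ 2 ∣ M₁ → ¬ ℓ ∣ D * A → 3 * ℓ < M₁ * D * A → cuspCoeff D₀.f ℓ = 0 →
        Squarefree D → Nat.Coprime D M₁ → Squarefree A → Nat.Coprime A D →
        (∀ p : ℕ, p.Prime → p ∣ A → p ∣ M₁ ∧ ¬ p ^ 2 ∣ M₁ ∧ cuspCoeff D₀.f p = 0) →
        (∀ p : ℕ, p.Prime → p ∣ D → ∃ u : ℤ, u * u = 1 ∧ cuspCoeff D₀.f p = u) →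
        (∀ ι : PadicAlgCl 3 ≃+* ℂ, ∃ g : CuspForm (Gamma0 M₁) 2, IsNewform0 g ∧
          (∀ p : ℕ, p.Prime → ¬ p ∣ D * A * ℓ → Valued.v (ι.symm (cuspCoeff D₀.f p - cuspCoeff g p)) < 1) ∧
          (∀ p : ℕ, p.Prime → p ∣ D → Valued.v (ι.symm (cuspCoeff g p - cuspCoeff D₀.f p * (p + 1))) < 1)) →
        ∃ d : ℕ, kuriharaPartialDeepInfty W₀ 3 D₀.f = d ∧
          kuriharaPartial W₀ 3 D₀.f 0 ≤
            ((padicValNat 3 (Nat.card (AddCommGroup.primaryComponent W₀.sha 3)) + d : ℕ) : ℕ∞) := by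
  intro W₀ _ _ htower hfin N _ hN D₀ hopt hdeg hint hord hnA hordinary hram hv M₁ D A ℓ _ _ v hMDℓ hvℓ hadd h3Φ h3c
    hℓM₁ hℓ2M₁ hℓDA h3ℓ hfℓ hDsq hDM₁ hAsq hAD hA hsign hex
  obtain ⟨π, hLL⟩ := isStabilisedLevelLoweringCongruenceIn_of_exists_levelLoweredNewform_depleteAt hDR hCa hCE hV hGV W₀
    htower hN D₀ hint hnA v hMDℓ hvℓ hadd h3Φ h3c hℓM₁ hℓ2M₁ hℓDA h3ℓ hfℓ hDsq hDM₁ hAsq hAD hA hsign hex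
  exact stub_nonAdditive_covered_of_plusSymbolLevelLowersOver hYZ hW20 hSk hmod hGZK hM W₀ htower hfin hN D₀ hopt hdeg
    hint hord hnA hordinary hram hv π ℓ (by rw [← hN, ← hMDℓ]; exact dvd_mul_left ℓ _)
    (plusSymbolLevelLowersOver_three_of_isStabilisedLevelLoweringCongruenceIn W₀ D₀.f ℓ π hLL)


end Rows

/-! ### §2 ★¹³ᶜ The (A) class, covered consumer -/

section ClassA

/-- ★¹³ᶜ **`stub_nonAdditive` on the CLASS of depth-`1` rows whose Tamagawa `3` sits at an additive prime `ℓ` (`ℓ² ∣ N`,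
`3 ∣ c_ℓ`), `N > 3ℓ²`, `f = 2` at the `IV`/`IV*` places — COVERED version: «ordinary if good, (ram) if multiplicative»
in place of `Ram W₀ 3`** (★¹³ᵃ's certificate fed to `…LevelLoweringBridge.stub_nonAdditive_covered_of_plusSymbolLevelLowersOver`;
TWELVE named facts, the Yan–Zhu binder PRE-tier print). [cite: YanZhu2024MainConjNonCM, Thm. 4.15 (§4.6)]
[cite: Skinner2016PacificMC, Thm. C (§1)] [cite: DiamondRibet1997, §4.5 Lemma 4.6] [cite: DarmonDiamondTaylor1995, Thm. 3.15, Thm. 3.1 (e)] -/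
theorem stub_nonAdditive_covered_tamagawaDepthOne_of_additiveTamagawa
    (hRk : ribet1990_levelLowering_gamma0_newform_at_three_additiveDrop)
    (hDR : diamondRibet1997_iharaLemma_at_dividingPrime_three_additive)
    (hCa : carayol1986_cuspCoeff_congr_at_additiveDrop_three)
    (hCE : colemanEdixhoven1998_heckePolynomial_simpleRoots)
    (hV : vatsal1999_plusSymbol_congruence) (hGV : greenbergVatsal2000_plusSymbol_congruence)
    (hYZ : YanZhu2026.thm415_padicValRat_bsd_rank_le_one)
    (hW20 : Wuthrich2014.lemma20_surjective_threeAdic_of_semistable)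
    (hSk : Skinner2016.thmC_padicValRat_bsd_rank_zero)
    (hmod : hasEntireLFunction_rat) (hGZK : rank_eq_analyticRank_of_analyticRank_le_one)
    (hM : mazur_not_dvd_maninConstant_of_odd) :
    ∀ (W₀ : WeierstrassCurve ℚ) [W₀.IsElliptic] [W₀.IsGloballyMinimal],
      (∀ n : ℕ, W₀.HasSurjectiveModNGaloisRep (3 ^ n : ℕ)) → Finite W₀.sha →
      ∀ {N : ℕ} [NeZero N], N = W₀.conductorNorm ℤ →
      ∀ (D₀ : ModularParametrizationData W₀ N),
        (∀ z ∈ D₀.L.lattice, ∃ w ∈ periodLattice D₀.f, z = D₀.c * w) →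
        (∀ (W₂ : WeierstrassCurve ℚ) [W₂.IsElliptic] (D₂ : ModularParametrizationData W₂ N),
          D₂.f = D₀.f → D₀.modularDegree ≤ D₂.modularDegree) →
        (∀ r : ℚ, ratPlusSymbol D₀.f r ≠ 0 → 0 ≤ padicValRat 3 (ratPlusSymbol D₀.f r)) →
        kuriharaVanishingOrder W₀ 3 D₀.f = 0 →
        ¬ (haveI : Fact (Nat.Prime 3) := ⟨Nat.prime_three⟩; Addv W₀ 3) →
        (W₀.HasGoodReductionAtPrime 3 → ¬ (3 : ℤ) ∣ W₀.frobeniusTrace 3) →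
        (W₀.HasMultiplicativeReductionAtPrime 3 →
          (haveI : Fact (Nat.Prime 3) := ⟨Nat.prime_three⟩; Ram W₀ 3)) →
        padicValNat 3 W₀.tamagawaProduct ≤ 1 →
        ∀ (ℓ : ℕ) (hℓ : ℓ.Prime), ℓ ^ 2 ∣ N → 3 ∣ (haveI := Fact.mk hℓ; (W₀.baseChange ℚ_[ℓ]).localTamagawaNumber ℤ_[ℓ]) →
        3 * ℓ ^ 2 < N →
        (∀ v : HeightOneSpectrum ℤ, W₀.HasAdditiveReductionAt v → 3 ∣ (W₀.kodairaSymbolAt v).componentGroupOrder →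
          ¬ natGenerator v ^ 3 ∣ N) →
        ∃ d : ℕ, kuriharaPartialDeepInfty W₀ 3 D₀.f = d ∧
          kuriharaPartial W₀ 3 D₀.f 0 ≤
            ((padicValNat 3 (Nat.card (AddCommGroup.primaryComponent W₀.sha 3)) + d : ℕ) : ℕ∞) := by
  intro W₀ _ _ htower hfin N _ hN D₀ hopt hdeg hint hord hnA hordinary hram hv ℓ hℓ hℓ2N h3c hbig hK3
  obtain ⟨π, hLL⟩ := isStabilisedLevelLoweringCongruenceIn_of_additiveTamagawa hRk hDR hCa hCE hV hGV W₀ htower hN D₀ hint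
    hnA ℓ hℓ hℓ2N h3c hbig hK3
  exact stub_nonAdditive_covered_of_plusSymbolLevelLowersOver hYZ hW20 hSk hmod hGZK hM W₀ htower hfin hN D₀ hopt hdeg
    hint hord hnA hordinary hram hv π ℓ (by rw [← hN]; exact (dvd_pow_self ℓ two_ne_zero).trans hℓ2N)
    (plusSymbolLevelLowersOver_three_of_isStabilisedLevelLoweringCongruenceIn W₀ D₀.f ℓ π hLL)

end ClassA

end Summit.BirchSwinnertonDyer.BirchSwinnertonDyer.Theorems.KimAtThreeDeepLowerOffStratumLevelLoweringDepleteTamagawaRowsCovered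

end
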